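import Mathlib
import Literature.AlgebraicGeometry.Resolution.FiniteQuotientSingularityPresentation
import Literature.RingTheory.GaloisAlgebras.ChaseHarrisonRosenbergEtale

/-!
# Affine quotients by finite groups are étale over the free locus `D(t)` (chain w45c, J2a)

(crux stmt-ResolutionOfSingularities-15640 `WildQuotients.WildQuotientResolution`, line `Sketch`;
support towards `JordanBlockFourfold` stmt-17942 ⇐ `CyclicQuotientFourfolds` stmt-17941;
[OURS · L1 W4.5c] — NOT a statement of any manuscript.)

Let the finite group `G` act by `k`-algebra automorphisms on the `k`-domain `S`, with ring of
invariants `A = S^G = FixedPoints.subalgebra k S G`, and let `t ∈ A` be a non-zero invariant lying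
in the augmentation ideal `(g • b - b : b ∈ S)` of every `g ≠ 1`. Then over the basic open
`D(t) ⊆ Spec A` the quotient map `q : Spec S → Spec A` is ÉTALE: on `S[1/t]` every augmentation
ideal contains the unit `t`, so the induced action is free in the sense of
Chase–Harrison–Rosenberg, its invariants are `A[1/t]` (invariants commute with localisation at an
invariant, `Literature.AlgebraicGeometry.Resolution.forall_smulAwayMap_eq_iff`), and a Galois
extension of rings is étale (`Literature.RingTheory.GaloisAlgebras.etale_of_free`). Since `D(t)` is
dense in the integral `Spec A`, `q` is generically étale (`exists_dense_etale_morphismRestrict`).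
Throughout, `t` is handled as an element of `A` and the localised map is Mathlib's
`Localization.awayMap (algebraMap A S) t : A[1/t] → S[1/t]`.

* `smul_awayMap_fixedPoints` — the image of `A[1/t] → S[1/t]` is fixed by `G`;
* `awayMap_fixedPoints_injective` — `A[1/t] → S[1/t]` is injective;
* `etale_awayMap_fixedPoints` — it is étale (ring form);
* `etale_morphismRestrict_basicOpen_fixedPoints`, `exists_dense_etale_morphismRestrict` — scheme form.
-/

-- single-problem summit: the doubled namespace component `ResolutionOfSingularities` is forced
set_option linter.dupNamespace false

noncomputable section

universe u

open CategoryTheory AlgebraicGeometry TopologicalSpace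
open Literature.AlgebraicGeometry.Resolution

namespace Summit.ResolutionOfSingularities.ResolutionOfSingularities.Theorems.WildQuotientResolution.AffineQuotient

variable (k : Type u) [Field k] {S : Type u} [CommRing S] [Algebra k S]
  {G : Type u} [Group G] [MulSemiringAction G S] [SMulCommClass G k S]

/-- An element of `A = S^G`, viewed in `S`, is `G`-invariant. [folklore] -/
theorem smul_algebraMap_fixedPoints (t : FixedPoints.subalgebra k S G) (g : G) :
    g • algebraMap (FixedPoints.subalgebra k S G) S t = algebraMap (FixedPoints.subalgebra k S G) S t :=
  t.2 g

/-- **The image of `A[1/t] → S[1/t]` is fixed by `G`** (`A = S^G`, `t ∈ A`, `G` acting on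
`S[1/t]` by `g • (s/tⁿ) = (g • s)/tⁿ`, `Literature.AlgebraicGeometry.Resolution.smulAwayMap`): both
`g ∘ φ` and `φ` are ring maps out of the localisation `A[1/t]` agreeing on `A`. [folklore] -/
theorem smul_awayMap_fixedPoints (t : FixedPoints.subalgebra k S G) (g : G)
    (x : Localization.Away t) :
    smulAwayMap G (algebraMap (FixedPoints.subalgebra k S G) S t) (smul_algebraMap_fixedPoints k t) g
        (Localization.awayMap (algebraMap (FixedPoints.subalgebra k S G) S) t x) =
      Localization.awayMap (algebraMap (FixedPoints.subalgebra k S G) S) t x := by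
  have hφ : ∀ a : FixedPoints.subalgebra k S G,
      Localization.awayMap (algebraMap (FixedPoints.subalgebra k S G) S) t
          (algebraMap (FixedPoints.subalgebra k S G) _ a) =
        algebraMap S _ (algebraMap (FixedPoints.subalgebra k S G) S a) :=
    fun a => IsLocalization.map_eq _ a
  have key : (smulAwayMap G (algebraMap (FixedPoints.subalgebra k S G) S t)
      (smul_algebraMap_fixedPoints k t) g).comp
        (Localization.awayMap (algebraMap (FixedPoints.subalgebra k S G) S) t) =
      Localization.awayMap (algebraMap (FixedPoints.subalgebra k S G) S) t := by
    refine IsLocalization.ringHom_ext (Submonoid.powers t) ?_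
    ext a
    rw [RingHom.comp_apply, RingHom.comp_apply, RingHom.comp_apply, hφ, smulAwayMap_algebraMap]
    exact congrArg _ (a.2 g)
  exact DFunLike.congr_fun key x

/-- **`A[1/t] → S[1/t]` is injective** when `S` is a domain and `t ≠ 0`. [folklore] -/
theorem awayMap_fixedPoints_injective [IsDomain S] (t : FixedPoints.subalgebra k S G)
    (ht0 : t ≠ 0) :
    Function.Injective (Localization.awayMap (algebraMap (FixedPoints.subalgebra k S G) S) t) := by
  have ht0' : algebraMap (FixedPoints.subalgebra k S G) S t ≠ 0 := fun h =>
    ht0 (Subtype.ext h)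
  have hφ : ∀ a : FixedPoints.subalgebra k S G,
      Localization.awayMap (algebraMap (FixedPoints.subalgebra k S G) S) t
          (algebraMap (FixedPoints.subalgebra k S G) _ a) =
        algebraMap S _ (algebraMap (FixedPoints.subalgebra k S G) S a) :=
    fun a => IsLocalization.map_eq _ a
  rw [injective_iff_map_eq_zero]
  intro x hx
  obtain ⟨⟨a, s⟩, hs⟩ := IsLocalization.surj (Submonoid.powers t) x
  -- `x * s = a` with `s = t ^ n`; apply `φ`: `φ a = 0`, so `a = 0`
  have h1 : Localization.awayMap (algebraMap (FixedPoints.subalgebra k S G) S) t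
      (algebraMap (FixedPoints.subalgebra k S G) _ a) = 0 := by
    rw [← hs, map_mul, hx, zero_mul]
  rw [hφ, IsLocalization.map_eq_zero_iff
    (Submonoid.powers (algebraMap (FixedPoints.subalgebra k S G) S t))] at h1
  obtain ⟨⟨_, m, rfl⟩, hm⟩ := h1
  have ha : algebraMap (FixedPoints.subalgebra k S G) S a = 0 := by
    rcases mul_eq_zero.mp hm with h | h
    · exact absurd h (pow_ne_zero m ht0')
    · exact h
  have ha' : a = 0 := Subtype.ext ha
  rw [ha', map_zero] at hs
  have hu : IsUnit (algebraMap (FixedPoints.subalgebra k S G) (Localization.Away t)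
      (s : FixedPoints.subalgebra k S G)) :=
    IsLocalization.map_units _ s
  exact (IsUnit.mul_left_eq_zero hu).mp hs

/-- **Affine quotients are étale over the free locus (ring form).** Let the finite group `G` act
by `k`-algebra automorphisms on the `k`-domain `S`, `A = S^G`, and let `t ∈ A`, `t ≠ 0`, lie in
the augmentation ideal `(g • b - b : b)` of every `g ≠ 1`. Then `A[1/t] → S[1/t]` is étale: the
action of `G` on `S[1/t]` is free in the sense of Chase–Harrison–Rosenberg (each augmentation
ideal contains the unit `t`), its ring of invariants is the image of `A[1/t]`
(`forall_smulAwayMap_eq_iff`), so `S[1/t]` is a Galois extension of `A[1/t]`, hence étale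
(`Literature.RingTheory.GaloisAlgebras.etale_of_free`). [cite: SGA1, Exp. V, Prop. 2.6]
[cite: Greither1992CyclicGalois, Ch. 0 Thm. 1.6] -/
theorem etale_awayMap_fixedPoints [IsDomain S] [Finite G] (t : FixedPoints.subalgebra k S G)
    (ht0 : t ≠ 0)
    (hfree : ∀ g : G, g ≠ 1 → (t : S) ∈ Ideal.span (Set.range fun b : S => g • b - b)) :
    (Localization.awayMap (algebraMap (FixedPoints.subalgebra k S G) S) t).Etale := by
  classical
  let _ := Fintype.ofFinite G
  -- notation: `T = t ∈ S`, `A[1/t] = Localization.Away t`, `S[1/t] = Localization.Away T`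
  have hT : ∀ g : G, g • algebraMap (FixedPoints.subalgebra k S G) S t =
      algebraMap (FixedPoints.subalgebra k S G) S t := smul_algebraMap_fixedPoints k t
  have hφ : ∀ a : FixedPoints.subalgebra k S G,
      Localization.awayMap (algebraMap (FixedPoints.subalgebra k S G) S) t
          (algebraMap (FixedPoints.subalgebra k S G) _ a) =
        algebraMap S _ (algebraMap (FixedPoints.subalgebra k S G) S a) :=
    fun a => IsLocalization.map_eq _ a
  -- the `A[1/t]`-algebra `S[1/t]` and the action of `G` on it
  letI algφ : Algebra (Localization.Away t)
      (Localization.Away (algebraMap (FixedPoints.subalgebra k S G) S t)) :=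
    (Localization.awayMap (algebraMap (FixedPoints.subalgebra k S G) S) t).toAlgebra
  have halg : ∀ x, algebraMap (Localization.Away t)
      (Localization.Away (algebraMap (FixedPoints.subalgebra k S G) S t)) x =
        Localization.awayMap (algebraMap (FixedPoints.subalgebra k S G) S) t x := fun _ => rfl
  letI : MulSemiringAction G (Localization.Away (algebraMap (FixedPoints.subalgebra k S G) S t)) :=
    awayMulSemiringAction G _ hT
  have hsmul : ∀ (g : G) (y : Localization.Away (algebraMap (FixedPoints.subalgebra k S G) S t)),
      g • y = smulAwayMap G _ hT g y := fun _ _ => rfl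
  have hfix : ∀ (g : G) (x : Localization.Away t),
      g • Localization.awayMap (algebraMap (FixedPoints.subalgebra k S G) S) t x =
        Localization.awayMap (algebraMap (FixedPoints.subalgebra k S G) S) t x := fun g x => by
    rw [hsmul]
    exact smul_awayMap_fixedPoints k t g x
  haveI : SMulCommClass G (Localization.Away t)
      (Localization.Away (algebraMap (FixedPoints.subalgebra k S G) S t)) :=
    ⟨fun g x y => by rw [Algebra.smul_def, Algebra.smul_def, smul_mul', halg, hfix]⟩
  haveI : FaithfulSMul (Localization.Away t)
      (Localization.Away (algebraMap (FixedPoints.subalgebra k S G) S t)) :=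
    (faithfulSMul_iff_algebraMap_injective _ _).mpr (awayMap_fixedPoints_injective k t ht0)
  -- invariants of `S[1/t]` come from `A[1/t]`
  haveI : Algebra.IsInvariant (Localization.Away t)
      (Localization.Away (algebraMap (FixedPoints.subalgebra k S G) S t)) G := by
    refine ⟨fun y hy => ?_⟩
    obtain ⟨n, s, hs, hy'⟩ := (forall_smulAwayMap_eq_iff hT y).mp fun g => (hsmul g y) ▸ hy g
    obtain ⟨z, hz⟩ : ∃ z : Localization.Away t,
        z * algebraMap (FixedPoints.subalgebra k S G) _ (t ^ n) =
          algebraMap (FixedPoints.subalgebra k S G) _ (⟨s, hs⟩ : FixedPoints.subalgebra k S G) :=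
      ⟨IsLocalization.mk' (Localization.Away t) (⟨s, hs⟩ : FixedPoints.subalgebra k S G)
          (⟨t ^ n, n, rfl⟩ : Submonoid.powers t), IsLocalization.mk'_spec _ _ _⟩
    refine ⟨z, ?_⟩
    rw [halg]
    have h1 : Localization.awayMap (algebraMap (FixedPoints.subalgebra k S G) S) t z *
        algebraMap S _ (algebraMap (FixedPoints.subalgebra k S G) S t) ^ n =
          algebraMap S _ s := by
      have := congrArg (Localization.awayMap (algebraMap (FixedPoints.subalgebra k S G) S) t) hz
      rw [map_mul, hφ, hφ, map_pow, map_pow] at this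
      exact this
    have hu : IsUnit (algebraMap S (Localization.Away (algebraMap (FixedPoints.subalgebra k S G) S t))
        (algebraMap (FixedPoints.subalgebra k S G) S t) ^ n) :=
      (IsLocalization.Away.algebraMap_isUnit _).pow n
    rw [mul_comm] at hy'
    exact hu.mul_left_injective (h1.trans hy'.symm)
  -- the action on `S[1/t]` is free: each augmentation ideal contains the unit `t`
  have hfree' : ∀ g : G, g ≠ 1 →
      Ideal.span (Set.range fun b : Localization.Away (algebraMap (FixedPoints.subalgebra k S G) S t)
        => g • b - b) = ⊤ := by
    intro g hg
    have hle : (Ideal.span (Set.range fun b : S => g • b - b)).map (algebraMap S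
        (Localization.Away (algebraMap (FixedPoints.subalgebra k S G) S t))) ≤
          Ideal.span (Set.range fun b :
            Localization.Away (algebraMap (FixedPoints.subalgebra k S G) S t) => g • b - b) := by
      rw [Ideal.map_span]
      refine Ideal.span_le.mpr ?_
      rintro _ ⟨_, ⟨b, rfl⟩, rfl⟩
      refine Ideal.subset_span ⟨algebraMap S _ b, ?_⟩
      simp only [map_sub, hsmul, smulAwayMap_algebraMap]
    have hmem : algebraMap (FixedPoints.subalgebra k S G) S t ∈
        Ideal.span (Set.range fun b : S => g • b - b) := hfree g hg
    exact Ideal.eq_top_of_isUnit_mem _ (hle (Ideal.mem_map_of_mem _ hmem))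
      (IsLocalization.Away.algebraMap_isUnit _)
  have hE : Algebra.Etale (Localization.Away t)
      (Localization.Away (algebraMap (FixedPoints.subalgebra k S G) S t)) :=
    Literature.RingTheory.GaloisAlgebras.etale_of_free (Localization.Away t) G hfree'
  exact RingHom.etale_algebraMap.mpr hE

/-- **Scheme form: `q : Spec S → Spec S^G` is étale over `D(t)`** for an invariant `t ≠ 0` lying
in every augmentation ideal (`etale_awayMap_fixedPoints` transported along Mathlib's
`SpecMapRestrictBasicOpenIso`). [cite: SGA1, Exp. V, Prop. 2.6] -/
theorem etale_morphismRestrict_basicOpen_fixedPoints [IsDomain S] [Finite G]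
    (t : FixedPoints.subalgebra k S G) (ht0 : t ≠ 0)
    (hfree : ∀ g : G, g ≠ 1 → (t : S) ∈ Ideal.span (Set.range fun b : S => g • b - b)) :
    Etale (Spec.map (CommRingCat.ofHom (algebraMap (FixedPoints.subalgebra k S G) S)) ∣_
      PrimeSpectrum.basicOpen t) := by
  rw [MorphismProperty.arrow_mk_iso_iff (P := @Etale) (SpecMapRestrictBasicOpenIso _ _),
    HasRingHomProperty.Spec_iff (P := @Etale), CommRingCat.hom_ofHom]
  exact etale_awayMap_fixedPoints k t ht0 hfree

/-- **`q : Spec S → Spec S^G` is generically étale**: under the same hypotheses there is a dense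
open of `Spec S^G` over which `q` is étale, namely `D(t)` (non-empty — it contains the generic
point, `S^G` being a domain — hence dense in the irreducible `Spec S^G`).
[cite: SGA1, Exp. V, Prop. 2.6] -/
theorem exists_dense_etale_morphismRestrict [IsDomain S] [Finite G]
    (t : FixedPoints.subalgebra k S G) (ht0 : t ≠ 0)
    (hfree : ∀ g : G, g ≠ 1 → (t : S) ∈ Ideal.span (Set.range fun b : S => g • b - b)) :
    ∃ U : (Spec (.of (FixedPoints.subalgebra k S G))).Opens,
      Dense (U : Set (Spec (.of (FixedPoints.subalgebra k S G)))) ∧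
      Etale (Spec.map (CommRingCat.ofHom (algebraMap (FixedPoints.subalgebra k S G) S)) ∣_ U) := by
  refine ⟨PrimeSpectrum.basicOpen t, ?_, etale_morphismRestrict_basicOpen_fixedPoints k t ht0 hfree⟩
  have hmem : (⟨⊥, Ideal.isPrime_bot⟩ : PrimeSpectrum (FixedPoints.subalgebra k S G)) ∈
      PrimeSpectrum.basicOpen t := by
    rw [PrimeSpectrum.mem_basicOpen]
    simp only [Submodule.mem_bot]
    exact ht0
  exact (PrimeSpectrum.basicOpen _).isOpen.dense ⟨_, hmem⟩

end Summit.ResolutionOfSingularities.ResolutionOfSingularities.Theorems.WildQuotientResolution.AffineQuotient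

end
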